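import Summits.MatrixMultiplication.MatrixMultiplication.Theorems.HyperoctahedralThreshold.Negative.SubgroupPivotSieve
import Literature.Barriers.MatrixMultiplication.YoungSubgroupBarrierSTPP

/-!
# `SnSubsetDichotomy.ThresholdSubsetTriples`, line `triality-uniquely-cubing-translate` — coset cap
# (Negative-side helper of crux `stmt-MatrixMultiplication-10882`, lead a1-0)

The subgroup-pivot sieve (`HyperoctahedralThreshold/Negative/SubgroupPivotSieve.lean`, `sieve`: a TPP
triple whose first set is a subgroup `H` has `|H|·|X₁|·|X₂| ≤ |G|·d_max(G)`) extends from a subgroup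
MEMBER to a conceded COSET: if `(S, T, U)` has the triple product property and `S ⊇ a·K` for a subgroup
`K`, then `|K|·|T|·|U| ≤ |G|·d_max(G)` (`stub_cosetCap`).  Proof: the TPP passes to the sub-triple
`(aK, T, U)` (`TripleProductProperty.mono`), `aK = (aKa⁻¹)·a` and right translation of one set preserves
the TPP (`tripleProductProperty_image_mul_right_iff`), so the sieve applies to the subgroup `aKa⁻¹`,
which has `|aKa⁻¹| = |K|`.

For the ℤ/3-symmetric witnesses of the triality lines (`T = gS`, `U = g²S`, `|T| = |U| = |S|`) this reads
`|K|·|S|² ≤ |G|·d_max(G)` (`triality_cosetCap`), and in `S_n` with the tree's Vershik–Kerov theorem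
(`d_max(S_n) ≤ √(n!)·e^{-(c₂-ε)√n}`, `c₂ = vkUpperConst`): for `n ≥ n₀`, a symmetric witness at scale
`c` (`√(n!)·e^{-c√n} < |S|`) contains no coset of a subgroup of order `≥ √(n!)·e^{-(c₂/2 - 2c)√n}`
(`stub_trialityCosetWindow`).  Consequence for the host family of `stub_trialityChainDesign` (chain
products `S = R_0 ⋯ R_{k-1}` along `K_0 ≥ ⋯ ≥ K_k = 1`): the maximal FULL bottom block
(`R_j` a full transversal for all `j ≥ i`, so `S ⊇ r·K_i`) has `|K_i| < √(n!)·e^{-(c₂/2-2c)√n}`, and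
every SUBGROUP member `(H, gH, g²H)` of the family (a coset of itself) is dead for `c < c₂/6`
(`|H|³ ≤ n!·d_max`): the line's bet is confined to entropy-exact NON-coset chain products.
-/

set_option linter.dupNamespace false

namespace Summit.MatrixMultiplication.MatrixMultiplication.Theorems.ThresholdSubsetTriples

open Literature.Combinatorics.Additive Literature.RepresentationTheory.FiniteGroups
  Literature.Barriers.MatrixMultiplication
open Summit.MatrixMultiplication.MatrixMultiplication.Theorems.HyperoctahedralThreshold.Negative

/-- **Coset cap** (registered stub `stub_cosetCap` of crux `stmt-MatrixMultiplication-10882`): in a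
finite group, if `(S, T, U)` has the triple product property and `S` contains the left coset `a·K` of a
subgroup `K`, then `|K|·|T|·|U| ≤ |G|·d_max(G)`.  (Sub-triple `(aK, T, U)`; `aK = (aKa⁻¹)a`; right
translation invariance; subgroup-pivot sieve for `aKa⁻¹`.) -/
theorem stub_cosetCap {G : Type} [Group G] [Fintype G] [DecidableEq G] (K : Subgroup G) (a : G)
    (S T U : Finset G) (hT : TripleProductProperty S T U) (hK : ∀ k : G, k ∈ K → a * k ∈ S) :
    Nat.card K * T.card * U.card ≤ Nat.card G * maxCharDegree G := by
  classical
  -- the conjugate subgroup `H = a K a⁻¹` and its underlying finset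
  let f : G →* G := (MulAut.conj a).toMonoidHom
  have hf : Function.Injective f := (MulAut.conj a).injective
  let H : Subgroup G := K.map f
  let SH : Finset G := Finset.univ.filter (· ∈ H)
  have hSH : ∀ x, x ∈ SH ↔ x ∈ H := fun x => by simp [SH]
  -- `SH · a ⊆ S`
  have hsub : SH.image (· * a) ⊆ S := by
    intro x hx
    obtain ⟨y, hy, rfl⟩ := Finset.mem_image.1 hx
    obtain ⟨k, hk, rfl⟩ := Subgroup.mem_map.1 ((hSH y).1 hy)
    have : f k * a = a * k := by
      show a * k * a⁻¹ * a = a * k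
      group
    rw [this]
    exact hK k hk
  -- TPP of `(SH·a, T, U)`, hence of `(SH, T, U)`
  have hT1 : TripleProductProperty (SH.image (· * a)) (T.image (· * (1 : G))) (U.image (· * (1 : G))) := by
    have hT0 : T.image (· * (1 : G)) = T := by simp
    have hU0 : U.image (· * (1 : G)) = U := by simp
    rw [hT0, hU0]
    exact hT.mono hsub (subset_refl _) (subset_refl _)
  have hT2 : TripleProductProperty SH T U :=
    (tripleProductProperty_image_mul_right_iff SH T U a 1 1).1 hT1
  have key := sieve H SH T U hSH hT2
  have hcard : Nat.card H = Nat.card K :=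
    (Nat.card_congr (K.equivMapOfInjective f hf).toEquiv).symm
  rwa [hcard] at key

/-- **Triality coset cap**: a ℤ/3-symmetric witness `(S, gS, g²S)` with the triple product property that
contains a coset `a·K` has `|K|·|S|² ≤ |G|·d_max(G)`. -/
theorem triality_cosetCap {G : Type} [Group G] [Fintype G] [DecidableEq G] (K : Subgroup G) (a g : G)
    (S : Finset G) (hT : TripleProductProperty S (S.image (g * ·)) (S.image (g * g * ·)))
    (hK : ∀ k : G, k ∈ K → a * k ∈ S) :
    Nat.card K * S.card ^ 2 ≤ Nat.card G * maxCharDegree G := by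
  have key := stub_cosetCap K a S _ _ hT hK
  rwa [Finset.card_image_of_injective _ (mul_right_injective g),
    Finset.card_image_of_injective _ (mul_right_injective (g * g)), mul_assoc, ← sq] at key

/-- **Coset window for symmetric witnesses in `S_n`** (registered stub `stub_trialityCosetWindow`):
with `c₂ = vkUpperConst` there is `n₀` such that for `n ≥ n₀`, every ℤ/3-symmetric TPP witness
`(S, gS, g²S)` at scale `c` — `√(n!)·e^{-c√n} < |S|` — contains no left coset `a·K` of a subgroup with
`√(n!)·e^{-(c₂/2 - 2c)√n} ≤ |K|`.  (Triality coset cap + Vershik–Kerov at `ε = c₂/2`: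
`|K|·|S|² ≤ n!·d_max(S_n) ≤ n!·√(n!)·e^{-(c₂/2)√n}` against `|S|² > n!·e^{-2c√n}`.) -/
theorem stub_trialityCosetWindow : ∃ n₀ : ℕ, ∀ n ≥ n₀, ∀ (c : ℝ) (K : Subgroup (Equiv.Perm (Fin n)))
    (a g : Equiv.Perm (Fin n)) (S : Finset (Equiv.Perm (Fin n))),
    TripleProductProperty S (S.image (g * ·)) (S.image (g * g * ·)) →
    (∀ k, k ∈ K → a * k ∈ S) →
    Real.sqrt (n.factorial : ℝ) * Real.exp (-(c * Real.sqrt (n : ℝ))) < (S.card : ℝ) →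
    (Nat.card K : ℝ) < Real.sqrt (n.factorial : ℝ) * Real.exp (-((vkUpperConst / 2 - 2 * c) * Real.sqrt (n : ℝ))) := by
  have hc := vkUpperConst_pos
  obtain ⟨n₀, hn₀⟩ := VershikKerov1985_maxCharDegree_holds (vkUpperConst / 2) (by linarith)
  refine ⟨n₀, fun n hn c K a g S hT hK hS => ?_⟩
  classical
  have hnat := triality_cosetCap K a g S hT hK
  rw [show Nat.card (Equiv.Perm (Fin n)) = n.factorial by
      rw [Nat.card_eq_fintype_card, Fintype.card_perm, Fintype.card_fin]] at hnat
  have hreal : (Nat.card K : ℝ) * (S.card : ℝ) ^ 2 ≤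
      (n.factorial : ℝ) * (maxCharDegree (Equiv.Perm (Fin n)) : ℝ) := by exact_mod_cast hnat
  have hVK := (show vkUpperConst - vkUpperConst / 2 = vkUpperConst / 2 by ring) ▸ (hn₀ n hn).2
  set F : ℝ := (n.factorial : ℝ) with hF
  have hFpos : 0 < F := by
    rw [hF]; exact_mod_cast Nat.factorial_pos n
  set r : ℝ := Real.sqrt (n : ℝ) with hr
  have h0 : 0 ≤ Real.sqrt F * Real.exp (-(c * r)) := by positivity
  -- |S|² > F · e^{-2 c r}
  have hS2 : F * Real.exp (-(2 * c * r)) < (S.card : ℝ) ^ 2 := by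
    have h1 : (Real.sqrt F * Real.exp (-(c * r))) ^ 2 < (S.card : ℝ) ^ 2 :=
      pow_lt_pow_left₀ hS h0 two_ne_zero
    have h2 : (Real.sqrt F * Real.exp (-(c * r))) ^ 2 = F * Real.exp (-(2 * c * r)) := by
      rw [mul_pow, Real.sq_sqrt hFpos.le, ← Real.exp_nat_mul]
      congr 2
      push_cast
      ring
    rwa [h2] at h1
  -- |K| · F e^{-2cr} < |K| |S|² ≤ F · d_max ≤ F √F e^{-(c₂/2) r}  (when |K| > 0; |K| ≥ 1 always)
  have hKpos : (0 : ℝ) < (Nat.card K : ℝ) := by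
    have : 0 < Nat.card K := Nat.card_pos
    exact_mod_cast this
  have h3 : (Nat.card K : ℝ) * (F * Real.exp (-(2 * c * r))) <
      F * (Real.sqrt F * Real.exp (-(vkUpperConst / 2 * r))) :=
    calc (Nat.card K : ℝ) * (F * Real.exp (-(2 * c * r)))
        < (Nat.card K : ℝ) * (S.card : ℝ) ^ 2 := mul_lt_mul_of_pos_left hS2 hKpos
      _ ≤ F * (maxCharDegree (Equiv.Perm (Fin n)) : ℝ) := hreal
      _ ≤ F * (Real.sqrt F * Real.exp (-(vkUpperConst / 2 * r))) :=
          mul_le_mul_of_nonneg_left hVK hFpos.le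
  -- divide by F e^{-2cr} > 0
  have h4 : (Nat.card K : ℝ) < Real.sqrt F * Real.exp (-(vkUpperConst / 2 * r)) / Real.exp (-(2 * c * r)) := by
    rw [lt_div_iff₀ (Real.exp_pos _)]
    have h5 : (Nat.card K : ℝ) * (F * Real.exp (-(2 * c * r))) = F * ((Nat.card K : ℝ) * Real.exp (-(2 * c * r))) := by
      ring
    rw [h5] at h3
    exact lt_of_mul_lt_mul_left h3 hFpos.le
  have h6 : Real.sqrt F * Real.exp (-(vkUpperConst / 2 * r)) / Real.exp (-(2 * c * r)) =
      Real.sqrt F * Real.exp (-((vkUpperConst / 2 - 2 * c) * r)) := by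
    rw [mul_div_assoc, ← Real.exp_sub]
    congr 2
    ring
  rwa [h6] at h4

end Summit.MatrixMultiplication.MatrixMultiplication.Theorems.ThresholdSubsetTriples
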